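import Mathlib
import Summits.KontsevichZagierPeriods.KontsevichZagierPeriods.Theorems.InverseLandauTateFamilyKernelStubFaceQuotient
import Summits.KontsevichZagierPeriods.KontsevichZagierPeriods.Theorems.InverseLandauTateFamilyKernelStubQhFaceMoments

/-!
# Crux `TateFamilyKernel` (stmt-KontsevichZagierPeriods-9130), line `Sketch`:
# stub `stub_faceRationalIdentity` (wave 15 — the rational identity of the two face densities)

Variables `X 0 = s`, `X 1 = ϖ`; face denominators `D_a = 1 − ϖτ_a(s)`, `D_b = 1 − ϖτ_b(s)` with
`τ_a, τ_b ∈ ℚ[s]` positive on `[0,1]`. From the Hermite forms of the two faces,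
`c_a(ϖ)N_a = ∂_sM_a·D_a − k·M_a·∂_sD_a + R_a·D_a^k` (and the same for `b`), and the vanishing of
`∫₀¹ (N_a/D_a^{k+1} + N_b/D_b^{k+1}) ds` for `ϖ ∈ (0,b₁)` we derive, for the `ϖ`-independent
densities `f_a(s) = (c_bR_a)(s, 1/τ_a(s))`, `f_b(s) = (c_aR_b)(s, 1/τ_b(s))`, a rational identity
`B(ϖ)·[∫₀¹ f_a/(1 − ϖτ_a) + ∫₀¹ f_b/(1 − ϖτ_b)] = A(ϖ)` on `(0,b₁)` with real polynomials `A`,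
`B ≠ 0`.

* `FaceRationalIdentity.face_ftc` (FTC along `s`): dividing the Hermite form by `D^{k+1}` gives
  `c(ϖ)N/D^{k+1} = ∂_s(M/D^k) + R/D` pointwise on `[0,1]` (`QhFaceMoments.hasDerivAt_aeval_left`,
  quotient rule, `FaceRationalIdentity.quot_identity`), hence
  `c(ϖ)∫₀¹ N/D^{k+1} = [M/D^k]₀¹ + ∫₀¹ R/D` (`intervalIntegral.integral_eq_sub_of_hasDerivAt`).
* Multiplying the vanishing by `c_a(ϖ)c_b(ϖ)` and applying the face difference quotient
  `stub_faceQuotient` to `c_bR_a` and `c_aR_b` expresses `∫ f_a/D_a + ∫ f_b/D_b` as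
  `−Pol_a(ϖ) − Pol_b(ϖ) − c_b(ϖ)[M_a/D_a^k]₀¹ − c_a(ϖ)[M_b/D_b^k]₀¹`.
* The endpoint terms are rational in `ϖ` with denominator dividing
  `B = [(1−ϖτ_a(1))(1−ϖτ_a(0))(1−ϖτ_b(1))(1−ϖτ_b(0))]^k` (`B(0) = 1`, so `B ≠ 0`); the slices
  `ϖ ↦ M(x, ϖ)` are real polynomials (`FaceRationalIdentity.exists_slice_poly`).
* The bound `|τ(s)|·b₁ ≤ 1` on `[0,1]`: otherwise `ϖ = 1/τ(s) ∈ (0,b₁)` kills the denominator.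

Mathlib plus the landed siblings `…StubFaceQuotient` (`stub_faceQuotient`) and `…StubQhFaceMoments`
(slice calculus); no named fact, no new definition. Helpers live in `FaceRationalIdentity`.
-/

noncomputable section

open MeasureTheory Set MvPolynomial
open Literature.NumberTheory.Transcendental

namespace Summit.KontsevichZagierPeriods.InverseLandau.TateFamilyKernel.Descent

namespace FaceRationalIdentity

/-- Evaluation of `τ(X 0)` at the real point `(s, ϖ)` is `τ(s)`. [folklore] -/
theorem aeval_tau (τ : Polynomial ℚ) (s ϖ : ℝ) :
    aeval (![s, ϖ] : Fin 2 → ℝ) (Polynomial.aeval (X 0 : MvPolynomial (Fin 2) ℚ) τ) =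
      Polynomial.aeval s τ := by
  rw [← Polynomial.aeval_algHom_apply, aeval_X, Matrix.cons_val_zero]

/-- Evaluation of the face denominator `1 − X 1·τ(X 0)` at `(s, ϖ)` is `1 − ϖτ(s)`. [folklore] -/
theorem aeval_den (τ : Polynomial ℚ) (s ϖ : ℝ) :
    aeval (![s, ϖ] : Fin 2 → ℝ) (1 - X 1 * Polynomial.aeval (X 0 : MvPolynomial (Fin 2) ℚ) τ) =
      1 - ϖ * Polynomial.aeval s τ := by
  rw [map_sub, map_one, map_mul, aeval_tau, aeval_X]
  rfl

/-- Evaluation of `c(X 1)·R` at `(s, ϖ)` is `c(ϖ)·R(s, ϖ)`. [folklore] -/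
theorem aeval_cmul (c : Polynomial ℚ) (R : MvPolynomial (Fin 2) ℚ) (s ϖ : ℝ) :
    aeval (![s, ϖ] : Fin 2 → ℝ) (Polynomial.aeval (X 1 : MvPolynomial (Fin 2) ℚ) c * R) =
      Polynomial.aeval ϖ c * aeval (![s, ϖ] : Fin 2 → ℝ) R := by
  rw [map_mul, ← Polynomial.aeval_algHom_apply, aeval_X]
  rfl

/-- The quotient-rule numerator of `M/D^k` against the Hermite form: if
`c·n = m'·d − k·m·d' + r·d^k` and `d ≠ 0` then
`(m'd^k − m·(k d^{k-1} d'))/(d^k)² = c·(n/d^{k+1}) − r/d`. [folklore] -/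
theorem quot_identity {c n m m' d d' r : ℝ} (k : ℕ) (hd : d ≠ 0)
    (hH : c * n = m' * d - k * (m * d') + r * d ^ k) :
    (m' * d ^ k - m * (k * d ^ (k - 1) * d')) / (d ^ k) ^ 2 = c * (n / d ^ (k + 1)) - r / d := by
  have hk : (k : ℝ) * d ^ (k - 1) * d = k * d ^ k := by
    cases k with
    | zero => simp
    | succ j => simp [pow_succ, mul_assoc]
  rw [mul_div_assoc', div_sub_div _ _ (pow_ne_zero _ hd) hd,
    div_eq_div_iff (pow_ne_zero _ (pow_ne_zero _ hd)) (mul_ne_zero (pow_ne_zero _ hd) hd)]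
  linear_combination (-(m * d' * d ^ (k + 1))) * hk - d ^ (2 * k + 1) * hH

/-- The face integrands `N(s,ϖ)/(1 − ϖτ(s))^n` are interval integrable on `[0,1]` as soon as the
denominator does not vanish there. [folklore] -/
theorem intervalIntegrable_face (N : MvPolynomial (Fin 2) ℚ) (τ : Polynomial ℚ) (n : ℕ) {ϖ : ℝ}
    (hϖ : ∀ s ∈ Icc (0 : ℝ) 1, 1 - ϖ * Polynomial.aeval s τ ≠ 0) :
    IntervalIntegrable (fun s => aeval (![s, ϖ] : Fin 2 → ℝ) N /
      (1 - ϖ * Polynomial.aeval s τ) ^ n) volume 0 1 := by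
  refine ContinuousOn.intervalIntegrable_of_Icc zero_le_one (ContinuousOn.div ?_ ?_ ?_)
  · exact (QhFaceMoments.continuous_aeval_vec continuous_id continuous_const N).continuousOn
  · fun_prop
  · exact fun s hs => pow_ne_zero _ (hϖ s hs)

/-- **FTC for one face.** From the Hermite form `c(X 1)·N = ∂_sM·D − k·M·∂_sD + R·D^k`,
`D = 1 − X 1·τ(X 0)`, and `1 − ϖτ ≠ 0` on `[0,1]`:
`c(ϖ)·∫₀¹ N/D^{k+1} ds = [M/D^k]₀¹ + ∫₀¹ R/D ds` at the parameter `ϖ`. [folklore] -/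
theorem face_ftc (τ : Polynomial ℚ) (k : ℕ) (N M R : MvPolynomial (Fin 2) ℚ) (c : Polynomial ℚ)
    (hH : Polynomial.aeval (X 1 : MvPolynomial (Fin 2) ℚ) c * N =
      pderiv 0 M * (1 - X 1 * Polynomial.aeval (X 0 : MvPolynomial (Fin 2) ℚ) τ) -
        C (k : ℚ) * (M * pderiv 0 (1 - X 1 * Polynomial.aeval (X 0 : MvPolynomial (Fin 2) ℚ) τ)) +
        R * (1 - X 1 * Polynomial.aeval (X 0 : MvPolynomial (Fin 2) ℚ) τ) ^ k)
    {ϖ : ℝ} (hϖ : ∀ s ∈ Icc (0 : ℝ) 1, 1 - ϖ * Polynomial.aeval s τ ≠ 0) :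
    Polynomial.aeval ϖ c *
        ∫ s in (0 : ℝ)..1, aeval (![s, ϖ] : Fin 2 → ℝ) N /
          (1 - ϖ * Polynomial.aeval s τ) ^ (k + 1) =
      aeval (![1, ϖ] : Fin 2 → ℝ) M / (1 - ϖ * Polynomial.aeval 1 τ) ^ k -
          aeval (![0, ϖ] : Fin 2 → ℝ) M / (1 - ϖ * Polynomial.aeval 0 τ) ^ k +
        ∫ s in (0 : ℝ)..1, aeval (![s, ϖ] : Fin 2 → ℝ) R / (1 - ϖ * Polynomial.aeval s τ) := by
  set D : MvPolynomial (Fin 2) ℚ := 1 - X 1 * Polynomial.aeval (X 0 : MvPolynomial (Fin 2) ℚ) τ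
    with hDdef
  have hDev : ∀ x : ℝ, aeval (![x, ϖ] : Fin 2 → ℝ) D = 1 - ϖ * Polynomial.aeval x τ :=
    fun x => aeval_den τ x ϖ
  -- the pointwise Hermite identity
  have hpt : ∀ x : ℝ, Polynomial.aeval ϖ c * aeval (![x, ϖ] : Fin 2 → ℝ) N =
      aeval (![x, ϖ] : Fin 2 → ℝ) (pderiv 0 M) * (1 - ϖ * Polynomial.aeval x τ) -
        k * (aeval (![x, ϖ] : Fin 2 → ℝ) M * aeval (![x, ϖ] : Fin 2 → ℝ) (pderiv 0 D)) +
        aeval (![x, ϖ] : Fin 2 → ℝ) R * (1 - ϖ * Polynomial.aeval x τ) ^ k := by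
    intro x
    have h := congrArg (aeval (![x, ϖ] : Fin 2 → ℝ)) hH
    rw [aeval_cmul] at h
    simp only [map_add, map_sub, map_mul, map_pow, hDev, map_natCast] at h
    exact h
  -- derivatives of the slices
  have hderD : ∀ x : ℝ, HasDerivAt (fun u : ℝ => 1 - ϖ * Polynomial.aeval u τ)
      (aeval (![x, ϖ] : Fin 2 → ℝ) (pderiv 0 D)) x := by
    intro x
    have h := QhFaceMoments.hasDerivAt_aeval_left D ϖ x
    simp only [hDev] at h
    exact h
  have hder : ∀ x ∈ uIcc (0 : ℝ) 1,
      HasDerivAt (fun u : ℝ => aeval (![u, ϖ] : Fin 2 → ℝ) M / (1 - ϖ * Polynomial.aeval u τ) ^ k)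
        (Polynomial.aeval ϖ c *
            (aeval (![x, ϖ] : Fin 2 → ℝ) N / (1 - ϖ * Polynomial.aeval x τ) ^ (k + 1)) -
          aeval (![x, ϖ] : Fin 2 → ℝ) R / (1 - ϖ * Polynomial.aeval x τ)) x := by
    intro x hx
    rw [uIcc_of_le zero_le_one] at hx
    have hdx := hϖ x hx
    exact ((QhFaceMoments.hasDerivAt_aeval_left M ϖ x).fun_div ((hderD x).fun_pow k)
      (pow_ne_zero k hdx)).congr_deriv (quot_identity k hdx (hpt x))
  -- integrability and the fundamental theorem of calculus
  have hi1 := intervalIntegrable_face N τ (k + 1) hϖ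
  have hi2 : IntervalIntegrable (fun s => aeval (![s, ϖ] : Fin 2 → ℝ) R /
      (1 - ϖ * Polynomial.aeval s τ)) volume 0 1 := by
    simpa only [pow_one] using intervalIntegrable_face R τ 1 hϖ
  have hftc := intervalIntegral.integral_eq_sub_of_hasDerivAt hder ((hi1.const_mul _).sub hi2)
  rw [intervalIntegral.integral_sub (hi1.const_mul _) hi2, intervalIntegral.integral_const_mul]
    at hftc
  linear_combination hftc

/-- The slice `ϖ ↦ M(x, ϖ)` of a `ℚ`-polynomial is a real polynomial function of `ϖ`. [folklore] -/
theorem exists_slice_poly (M : MvPolynomial (Fin 2) ℚ) (x : ℝ) :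
    ∃ P : Polynomial ℝ, ∀ ϖ : ℝ, P.eval ϖ = aeval (![x, ϖ] : Fin 2 → ℝ) M := by
  induction M using MvPolynomial.induction_on with
  | C a => exact ⟨Polynomial.C (algebraMap ℚ ℝ a), fun ϖ => by simp⟩
  | add p q hp hq =>
    obtain ⟨P, hP⟩ := hp
    obtain ⟨Q, hQ⟩ := hq
    exact ⟨P + Q, fun ϖ => by rw [Polynomial.eval_add, map_add, hP, hQ]⟩
  | mul_X p i hp =>
    obtain ⟨P, hP⟩ := hp
    fin_cases i
    · exact ⟨P * Polynomial.C x, fun ϖ => by simp [hP]⟩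
    · exact ⟨P * Polynomial.X, fun ϖ => by simp [hP]⟩

/-- If `t > 0` and `1 − ϖt ≠ 0` for all `ϖ ∈ (0,b)`, then `|t|·b ≤ 1` (else take `ϖ = 1/t`).
[folklore] -/
theorem abs_mul_le_one {t b : ℝ} (ht : 0 < t) (hne : ∀ ϖ ∈ Ioo (0 : ℝ) b, 1 - ϖ * t ≠ 0) :
    |t| * b ≤ 1 := by
  rw [abs_of_pos ht]
  by_contra hlt
  rw [not_le] at hlt
  have hϖ : t⁻¹ ∈ Ioo (0 : ℝ) b := ⟨inv_pos.mpr ht, (inv_lt_iff_one_lt_mul₀' ht).mpr hlt⟩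
  exact hne _ hϖ (by rw [inv_mul_cancel₀ ht.ne', sub_self])

/-- Clearing the common denominator `(A₁A₀B₁B₀)^k` of the endpoint terms. [folklore] -/
theorem clear_denoms {A1 A0 B1 B0 Pa Pb ca cb M1 M0 N1 N0 : ℝ} (k : ℕ) (hA1 : A1 ≠ 0)
    (hA0 : A0 ≠ 0) (hB1 : B1 ≠ 0) (hB0 : B0 ≠ 0) :
    (A1 * A0 * B1 * B0) ^ k *
        (-(Pa + Pb) - cb * (M1 / A1 ^ k - M0 / A0 ^ k) - ca * (N1 / B1 ^ k - N0 / B0 ^ k)) =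
      -(A1 * A0 * B1 * B0) ^ k * (Pa + Pb) - cb * (M1 * A0 ^ k - M0 * A1 ^ k) * (B1 * B0) ^ k -
        ca * (N1 * B0 ^ k - N0 * B1 ^ k) * (A1 * A0) ^ k := by
  rw [div_sub_div _ _ (pow_ne_zero k hA1) (pow_ne_zero k hA0),
    div_sub_div _ _ (pow_ne_zero k hB1) (pow_ne_zero k hB0)]
  simp only [mul_pow]
  field_simp

end FaceRationalIdentity

open FaceRationalIdentity in
/-- STUB `stub_faceRationalIdentity` (wave 15, calculus). **The rational identity of the two face
densities.** From the Hermite forms of the two faces (`c_a N_a = ∂_sM_a D_a − kM_a∂_sD_a + Ã D_a^k`,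
same for `b`) and the vanishing of `∫₀¹ (N_a/D_a^{k+1} + N_b/D_b^{k+1}) ds` for `ϖ ∈ (0,b₁)`: the
`ϖ`-independent densities `f_a(s) = (c_bÃ)(s, 1/τ_a(s))`, `f_b(s) = (c_aB̃)(s, 1/τ_b(s))` satisfy
`B(ϖ)·[∫₀¹ f_a/(1 − ϖτ_a) + ∫₀¹ f_b/(1 − ϖτ_b)] = A(ϖ)` on some `(0,b)` for real polynomials `A`,
`B ≠ 0` (FTC for `M/D^k` along `s`, `stub_faceQuotient`, and the common denominator
`[(1−ϖτ_a(1))(1−ϖτ_a(0))(1−ϖτ_b(1))(1−ϖτ_b(0))]^k`). [folklore] -/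
theorem stub_faceRationalIdentity (τa τb : Polynomial ℚ) (k : ℕ)
    (hτa : ∀ s ∈ Icc (0 : ℝ) 1, 0 < Polynomial.aeval s τa)
    (hτb : ∀ s ∈ Icc (0 : ℝ) 1, 0 < Polynomial.aeval s τb)
    (NA NB Ma Mb RA RB : MvPolynomial (Fin 2) ℚ) (ca cb : Polynomial ℚ)
    (hHa : Polynomial.aeval (X 1 : MvPolynomial (Fin 2) ℚ) ca * NA =
      pderiv 0 Ma * (1 - X 1 * Polynomial.aeval (X 0 : MvPolynomial (Fin 2) ℚ) τa) -
        C (k : ℚ) * (Ma * pderiv 0 (1 - X 1 * Polynomial.aeval (X 0 : MvPolynomial (Fin 2) ℚ) τa)) +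
        RA * (1 - X 1 * Polynomial.aeval (X 0 : MvPolynomial (Fin 2) ℚ) τa) ^ k)
    (hHb : Polynomial.aeval (X 1 : MvPolynomial (Fin 2) ℚ) cb * NB =
      pderiv 0 Mb * (1 - X 1 * Polynomial.aeval (X 0 : MvPolynomial (Fin 2) ℚ) τb) -
        C (k : ℚ) * (Mb * pderiv 0 (1 - X 1 * Polynomial.aeval (X 0 : MvPolynomial (Fin 2) ℚ) τb)) +
        RB * (1 - X 1 * Polynomial.aeval (X 0 : MvPolynomial (Fin 2) ℚ) τb) ^ k)
    (b₁ : ℝ) (hb₁ : 0 < b₁)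
    (hD : ∀ ϖ ∈ Ioo (0 : ℝ) b₁, ∀ s ∈ Icc (0 : ℝ) 1,
      1 - ϖ * Polynomial.aeval s τa ≠ 0 ∧ 1 - ϖ * Polynomial.aeval s τb ≠ 0)
    (hvan : ∀ ϖ ∈ Ioo (0 : ℝ) b₁, ∫ s in (0 : ℝ)..1,
      (aeval (![s, ϖ] : Fin 2 → ℝ) NA / (1 - ϖ * Polynomial.aeval s τa) ^ (k + 1) +
        aeval (![s, ϖ] : Fin 2 → ℝ) NB / (1 - ϖ * Polynomial.aeval s τb) ^ (k + 1)) = 0) :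
    ∃ (A B : Polynomial ℝ) (b : ℝ), 0 < b ∧ B ≠ 0 ∧
      (∀ s ∈ Icc (0 : ℝ) 1, |Polynomial.aeval s τa| * b ≤ 1 ∧ |Polynomial.aeval s τb| * b ≤ 1) ∧
      ∀ ϖ ∈ Ioo (0 : ℝ) b, B.eval ϖ *
        ((∫ s in (0 : ℝ)..1, aeval (![s, (Polynomial.aeval s τa)⁻¹] : Fin 2 → ℝ)
            (Polynomial.aeval (X 1 : MvPolynomial (Fin 2) ℚ) cb * RA) /
              (1 - ϖ * Polynomial.aeval s τa)) +
          ∫ s in (0 : ℝ)..1, aeval (![s, (Polynomial.aeval s τb)⁻¹] : Fin 2 → ℝ)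
            (Polynomial.aeval (X 1 : MvPolynomial (Fin 2) ℚ) ca * RB) /
              (1 - ϖ * Polynomial.aeval s τb)) =
        A.eval ϖ := by
  -- the face difference quotients and the polynomial slices of the endpoint terms
  obtain ⟨Pola, hPola⟩ :=
    stub_faceQuotient τa (Polynomial.aeval (X 1 : MvPolynomial (Fin 2) ℚ) cb * RA) hτa
  obtain ⟨Polb, hPolb⟩ :=
    stub_faceQuotient τb (Polynomial.aeval (X 1 : MvPolynomial (Fin 2) ℚ) ca * RB) hτb
  obtain ⟨PMa1, hPMa1⟩ := exists_slice_poly Ma 1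
  obtain ⟨PMa0, hPMa0⟩ := exists_slice_poly Ma 0
  obtain ⟨PMb1, hPMb1⟩ := exists_slice_poly Mb 1
  obtain ⟨PMb0, hPMb0⟩ := exists_slice_poly Mb 0
  have hlin : ∀ t : ℝ, ∃ Q : Polynomial ℝ, ∀ ϖ : ℝ, Q.eval ϖ = 1 - ϖ * t := fun t =>
    ⟨1 - Polynomial.X * Polynomial.C t, fun ϖ => by
      simp only [Polynomial.eval_sub, Polynomial.eval_one, Polynomial.eval_mul, Polynomial.eval_X,
        Polynomial.eval_C]⟩
  obtain ⟨Qa1, hQa1⟩ := hlin (Polynomial.aeval (1 : ℝ) τa)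
  obtain ⟨Qa0, hQa0⟩ := hlin (Polynomial.aeval (0 : ℝ) τa)
  obtain ⟨Qb1, hQb1⟩ := hlin (Polynomial.aeval (1 : ℝ) τb)
  obtain ⟨Qb0, hQb0⟩ := hlin (Polynomial.aeval (0 : ℝ) τb)
  have hcoef : ∀ c : Polynomial ℚ, ∃ Q : Polynomial ℝ, ∀ ϖ : ℝ, Q.eval ϖ = Polynomial.aeval ϖ c :=
    fun c => ⟨c.map (algebraMap ℚ ℝ), fun ϖ => by rw [Polynomial.eval_map, Polynomial.aeval_def]⟩
  obtain ⟨Ca, hCa⟩ := hcoef ca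
  obtain ⟨Cb, hCb⟩ := hcoef cb
  refine ⟨-(Qa1 * Qa0 * Qb1 * Qb0) ^ k * (Pola + Polb) -
      Cb * (PMa1 * Qa0 ^ k - PMa0 * Qa1 ^ k) * (Qb1 * Qb0) ^ k -
      Ca * (PMb1 * Qb0 ^ k - PMb0 * Qb1 ^ k) * (Qa1 * Qa0) ^ k,
    (Qa1 * Qa0 * Qb1 * Qb0) ^ k, b₁, hb₁, ?_, ?_, ?_⟩
  · -- `B ≠ 0` since `B(0) = 1`
    intro hB
    have h := congrArg (Polynomial.eval 0) hB
    simp [hQa1, hQa0, hQb1, hQb0] at h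
  · -- the bound `|τ|·b₁ ≤ 1`
    intro s hs
    exact ⟨abs_mul_le_one (hτa s hs) fun ϖ hϖ => (hD ϖ hϖ s hs).1,
      abs_mul_le_one (hτb s hs) fun ϖ hϖ => (hD ϖ hϖ s hs).2⟩
  · -- the identity on `(0, b₁)`
    intro ϖ hϖ
    have hDa : ∀ s ∈ Icc (0 : ℝ) 1, 1 - ϖ * Polynomial.aeval s τa ≠ 0 :=
      fun s hs => (hD ϖ hϖ s hs).1
    have hDb : ∀ s ∈ Icc (0 : ℝ) 1, 1 - ϖ * Polynomial.aeval s τb ≠ 0 :=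
      fun s hs => (hD ϖ hϖ s hs).2
    have h1 := face_ftc τa k NA Ma RA ca hHa hDa
    have h2 := face_ftc τb k NB Mb RB cb hHb hDb
    have h3 : (∫ s in (0 : ℝ)..1, aeval (![s, ϖ] : Fin 2 → ℝ) NA /
          (1 - ϖ * Polynomial.aeval s τa) ^ (k + 1)) +
        ∫ s in (0 : ℝ)..1, aeval (![s, ϖ] : Fin 2 → ℝ) NB /
          (1 - ϖ * Polynomial.aeval s τb) ^ (k + 1) = 0 := by
      rw [← intervalIntegral.integral_add (intervalIntegrable_face NA τa (k + 1) hDa)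
        (intervalIntegrable_face NB τb (k + 1) hDb)]
      exact hvan ϖ hϖ
    have hcm : ∀ (c : Polynomial ℚ) (R : MvPolynomial (Fin 2) ℚ) (τ : Polynomial ℚ),
        ∫ s in (0 : ℝ)..1, aeval (![s, ϖ] : Fin 2 → ℝ)
            (Polynomial.aeval (X 1 : MvPolynomial (Fin 2) ℚ) c * R) /
              (1 - ϖ * Polynomial.aeval s τ) =
          Polynomial.aeval ϖ c *
            ∫ s in (0 : ℝ)..1, aeval (![s, ϖ] : Fin 2 → ℝ) R / (1 - ϖ * Polynomial.aeval s τ) := by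
      intro c R τ
      rw [← intervalIntegral.integral_const_mul]
      refine intervalIntegral.integral_congr fun s _ => ?_
      simp only [aeval_cmul, mul_div_assoc]
    have h4 := hPola ϖ hDa
    have h5 := hPolb ϖ hDb
    rw [hcm] at h4 h5
    have hqa1 : 1 - ϖ * Polynomial.aeval 1 τa ≠ 0 := hDa 1 ⟨zero_le_one, le_rfl⟩
    have hqa0 : 1 - ϖ * Polynomial.aeval 0 τa ≠ 0 := hDa 0 ⟨le_rfl, zero_le_one⟩
    have hqb1 : 1 - ϖ * Polynomial.aeval 1 τb ≠ 0 := hDb 1 ⟨zero_le_one, le_rfl⟩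
    have hqb0 : 1 - ϖ * Polynomial.aeval 0 τb ≠ 0 := hDb 0 ⟨le_rfl, zero_le_one⟩
    set Sa := ∫ s in (0 : ℝ)..1, aeval (![s, (Polynomial.aeval s τa)⁻¹] : Fin 2 → ℝ)
      (Polynomial.aeval (X 1 : MvPolynomial (Fin 2) ℚ) cb * RA) / (1 - ϖ * Polynomial.aeval s τa)
      with hSa
    set Sb := ∫ s in (0 : ℝ)..1, aeval (![s, (Polynomial.aeval s τb)⁻¹] : Fin 2 → ℝ)
      (Polynomial.aeval (X 1 : MvPolynomial (Fin 2) ℚ) ca * RB) / (1 - ϖ * Polynomial.aeval s τb)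
      with hSb
    have hS : Sa + Sb = -(Pola.eval ϖ + Polb.eval ϖ) -
        Polynomial.aeval ϖ cb *
          (aeval (![1, ϖ] : Fin 2 → ℝ) Ma / (1 - ϖ * Polynomial.aeval 1 τa) ^ k -
            aeval (![0, ϖ] : Fin 2 → ℝ) Ma / (1 - ϖ * Polynomial.aeval 0 τa) ^ k) -
        Polynomial.aeval ϖ ca *
          (aeval (![1, ϖ] : Fin 2 → ℝ) Mb / (1 - ϖ * Polynomial.aeval 1 τb) ^ k -
            aeval (![0, ϖ] : Fin 2 → ℝ) Mb / (1 - ϖ * Polynomial.aeval 0 τb) ^ k) := by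
      linear_combination -h4 - h5 - Polynomial.aeval ϖ cb * h1 - Polynomial.aeval ϖ ca * h2 +
        Polynomial.aeval ϖ ca * Polynomial.aeval ϖ cb * h3
    rw [hS]
    simp only [Polynomial.eval_mul, Polynomial.eval_pow, Polynomial.eval_sub, Polynomial.eval_add,
      Polynomial.eval_neg, hQa1, hQa0, hQb1, hQb0, hCa, hCb, hPMa1, hPMa0, hPMb1, hPMb0]
    exact clear_denoms k hqa1 hqa0 hqb1 hqb0

end Summit.KontsevichZagierPeriods.InverseLandau.TateFamilyKernel.Descent

end
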